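import Literature.NumberTheory.Transcendental.ShidlovskyUniformity
import Literature.NumberTheory.Transcendental.EvaluationModuleJumps
import Mathlib.LinearAlgebra.Matrix.Rank
import Mathlib.LinearAlgebra.Matrix.NonsingularInverse
import Mathlib.RingTheory.Localization.Module
import Mathlib.Tactic
import HarnessLib

/-!
# Shidlovsky's lemma (Shidlovskii 1959; Mahler, LNM 546, Ch. 3 Theorem 6; CDT Theorem 37)

Final part of the formalization of **Shidlovsky's lemma** — the "functional bad approximability"
input `ord_{x=0}(Q_1 f_1 + … + Q_m f_m) ≤ m D + O(1)` of the fine holonomy bound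
[CalegariDimitrovTang2024, §3.2 Theorem 37; Basic Remark 38] — following K. Mahler,
*Lectures on transcendental numbers*, Ch. 3 §§53–58 and the remark on p. 72 [Mahler1976]:

* `exists_cols_det_ne_zero` — independent rows of a polynomial matrix admit a non-singular maximal
  minor (via the fraction field and `Matrix.rank`); `exists_complement` — complementary columns.
* `exists_order_bound` — Mahler's lemma (1): forms with coefficients of bounded degree have
  bounded order when non-zero (from `CalegariDimitrovTang.jumps_finite`).
* `exists_relation` — the rank relation `d λ_{μ+1} = Σ_{i≤μ} a_i λ_i` (§53 (8)).
* `shidlovsky` — the lemma: for `K[X]`-independent power series solutions `f` of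
  `κ f′ = B f` (`κ ≠ 0`; the origin may be a singular point) there is `C` with
  `λ(f) ≠ 0` and `ord λ(f) ≤ m·X + C` for every non-zero form `λ` of degree `≤ X`
  (full-rank case: `order_evalForm_le_of_det_ne_zero`; rank `μ < m`: the uniformity theorem at an
  auxiliary regular point, the forms `Λ_i = ε f_{I i} + Σ_j η_{ij} f_{J j}` of bounded degree
  (§54 (11), §57 (14)), Cramer with the `μ × μ` minor (§58 (18)–(22))).
* `shidlovsky_cdt` — the `deg Q_i < D ⟹ ord ≤ m D + C` form, and `shidlovsky_jumps` — the
  statement printed in [CalegariDimitrovTang2024, Theorem 37]: `𝒱(E_D) ⊆ {0,…,mD + C}` and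
  `#𝒱(E_D) = mD` for the evaluation modules `E_D` of `CalegariDimitrovTang.evalModule`;
  `shidlovsky_lowestOrder` — [CalegariDimitrovTang2024, Lemma 41] in the case `ε = 0` (with
  Corollary 34 `CalegariDimitrovTang.jumps_cartesian`).

## References
* [Mahler1976] K. Mahler, *Lectures on transcendental numbers*, LNM 546, Springer 1976, Ch. 3,
  Theorem 6 (§53) and §§53–58, remark p. 72.
* [CalegariDimitrovTang2024] F. Calegari, V. Dimitrov, Y. Tang, *The linear independence of 1,
  ζ(2) and L(2, χ₋₃)*, arXiv:2408.15403, §3.2 Theorem 37.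
-/

namespace Literature.NumberTheory.Transcendental

namespace Shidlovsky

open Polynomial Finset
open scoped PowerSeries Matrix

noncomputable section

/-! ### Column selection: a non-singular maximal minor -/

section Columns

variable {K : Type*} [Field K]

omit [Field K] in
/-- Over a field: a `μ × m` matrix with linearly independent rows has `μ` columns forming a
non-singular square submatrix. [folklore] -/
theorem exists_cols_det_ne_zero_field {F : Type*} [Field F] {μ m : ℕ} (A : Matrix (Fin μ) (Fin m) F)
    (hA : LinearIndependent F (fun h : Fin μ => A h)) :
    ∃ I : Fin μ → Fin m, Function.Injective I ∧ (A.submatrix id I).det ≠ 0 := by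
  classical
  obtain ⟨ι, a, ha, hspan, hli⟩ := exists_linearIndependent' F A.col
  haveI : Finite ι := Finite.of_injective a ha
  letI : Fintype ι := Fintype.ofFinite ι
  -- `card ι = rank A = μ`
  have hrank_row : A.rank = μ := by
    rw [Matrix.rank_eq_finrank_span_row]
    change Module.finrank F (Submodule.span F (Set.range fun h => A h)) = μ
    rw [finrank_span_eq_card hA, Fintype.card_fin]
  have hcard : Fintype.card ι = μ := by
    rw [← hrank_row, Matrix.rank_eq_finrank_span_cols, ← hspan, finrank_span_eq_card hli]
  let e : Fin μ ≃ ι := (Fintype.equivFinOfCardEq hcard).symm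
  refine ⟨a ∘ e, ha.comp e.injective, ?_⟩
  have hcols : LinearIndependent F (A.submatrix id (a ∘ e)).col := by
    have : (A.submatrix id (a ∘ e)).col = (A.col ∘ a) ∘ e := by
      funext k; rfl
    rw [this]
    exact hli.comp e e.injective
  have hunit := Matrix.linearIndependent_cols_iff_isUnit.mp hcols
  rw [Matrix.isUnit_iff_isUnit_det] at hunit
  exact hunit.ne_zero

/-- Over the domain `K[X]`: a `μ × m` polynomial matrix with `K[X]`-linearly independent rows
has `μ` columns forming a square submatrix of non-zero determinant (pass to the fraction field).
[folklore] -/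
theorem exists_cols_det_ne_zero {μ m : ℕ} (A : Matrix (Fin μ) (Fin m) K[X])
    (hA : LinearIndependent K[X] (fun h : Fin μ => A h)) :
    ∃ I : Fin μ → Fin m, Function.Injective I ∧ (A.submatrix id I).det ≠ 0 := by
  classical
  let F := FractionRing K[X]
  let φ : K[X] →+* F := algebraMap K[X] F
  have hφ : Function.Injective φ := IsFractionRing.injective K[X] F
  let AF : Matrix (Fin μ) (Fin m) F := A.map φ
  -- rows of `AF` are `K[X]`-independent, hence `F`-independent
  let L : (Fin m → K[X]) →ₗ[K[X]] (Fin m → F) := (Algebra.linearMap K[X] F).compLeft (Fin m)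
  have hL : LinearMap.ker L = ⊥ := by
    rw [LinearMap.ker_eq_bot']
    intro v hv
    funext k
    have := congrFun hv k
    simpa [L] using this
  have h1 : LinearIndependent K[X] (fun h : Fin μ => AF h) := hA.map' L hL
  have h2 : LinearIndependent F (fun h : Fin μ => AF h) :=
    (LinearIndependent.iff_fractionRing K[X] F).mp h1
  obtain ⟨I, hI, hdet⟩ := exists_cols_det_ne_zero_field AF h2
  refine ⟨I, hI, fun h0 => hdet ?_⟩
  have : AF.submatrix id I = (A.submatrix id I).map φ := rfl
  rw [this, ← RingHom.mapMatrix_apply, ← RingHom.map_det, h0, map_zero]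

omit [Field K] in
/-- Complementary columns: an injection `I : Fin μ → Fin m` extends by an enumeration `J` of the
remaining indices to a bijection `Fin μ ⊕ Fin (m − μ) ≃ Fin m`. [folklore] -/
theorem exists_complement {μ m : ℕ} (I : Fin μ → Fin m) (hI : Function.Injective I) :
    ∃ J : Fin (m - μ) → Fin m, Function.Bijective (Sum.elim I J) := by
  classical
  set s : Finset (Fin m) := Finset.univ.image I with hs
  have hscard : s.card = μ := by
    rw [hs, Finset.card_image_of_injective _ hI, Finset.card_univ, Fintype.card_fin]
  set t : Finset (Fin m) := Finset.univ \ s with ht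
  have htcard : t.card = m - μ := by
    rw [ht, Finset.card_sdiff_of_subset (Finset.subset_univ _), Finset.card_univ, Fintype.card_fin, hscard]
  let J : Fin (m - μ) → Fin m := fun j => t.orderEmbOfFin htcard j
  have hJmem : ∀ j, J j ∈ t := fun j => Finset.orderEmbOfFin_mem t htcard j
  have hJinj : Function.Injective J := fun j j' h => (t.orderEmbOfFin htcard).injective h
  have hnot : ∀ i j, I i ≠ J j := by
    intro i j h
    have : I i ∈ t := h ▸ hJmem j
    rw [ht, Finset.mem_sdiff] at this
    exact this.2 (Finset.mem_image.mpr ⟨i, Finset.mem_univ _, rfl⟩)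
  refine ⟨J, (Fintype.bijective_iff_injective_and_card _).mpr ⟨?_, ?_⟩⟩
  · rintro (i | j) (i' | j') h
    · simp only [Sum.elim_inl] at h; rw [hI h]
    · exact absurd h (hnot i j')
    · exact absurd h.symm (hnot i' j)
    · simp only [Sum.elim_inr] at h; rw [hJinj h]
  · have hμ : μ ≤ m := by
      rw [← hscard]; exact (Finset.card_le_univ s).trans (by simp)
    simp only [Fintype.card_sum, Fintype.card_fin]
    omega

end Columns

/-! ### Shidlovsky's lemma -/

section Main

variable {K : Type*} [Field K] [CharZero K] {m : ℕ}

/-- A non-zero polynomial over a field of characteristic zero has a non-root: a regular point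
exists. [folklore] -/
theorem exists_eval_ne_zero {κ : K[X]} (hκ : κ ≠ 0) : ∃ c : K, κ.eval c ≠ 0 := by
  classical
  haveI : Infinite K := Infinite.of_injective ((↑) : ℕ → K) Nat.cast_injective
  obtain ⟨c, hc⟩ := Infinite.exists_notMem_finset κ.roots.toFinset
  refine ⟨c, fun h => hc ?_⟩
  rw [Multiset.mem_toFinset, Polynomial.mem_roots hκ]
  exact h

omit [CharZero K] in
/-- The `K[X]`-action on `K⟦X⟧` is multiplication by the polynomial. [folklore] -/
theorem polynomial_smul_eq_coe_mul (p : K[X]) (g : K⟦X⟧) : p • g = (p : K⟦X⟧) * g := by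
  rw [Algebra.smul_def, PowerSeries.algebraMap_apply', Algebra.algebraMap_self]
  simp only [PowerSeries.map_id, id_eq]

omit [CharZero K] in
/-- **Mahler's lemma (1)**: forms in `f_1,…,f_m` with polynomial coefficients of bounded degree
take only finitely many orders (`CalegariDimitrovTang.jumps_finite`), hence their non-zero values
have bounded order. [cite: Mahler1976, Ch. 3 §45 lemma (1); §58 eq. (19)] -/
theorem exists_order_bound (f : Fin m → K⟦X⟧) (d₁ : ℕ) :
    ∃ C₄ : ℕ, ∀ g : Fin m → K[X], (∀ l, (g l).natDegree ≤ d₁) →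
      ∑ l, (g l : K⟦X⟧) * f l ≠ 0 → (∑ l, (g l : K⟦X⟧) * f l).order.toNat ≤ C₄ := by
  classical
  set E := CalegariDimitrovTang.evalModule f (d₁ + 1) with hE
  have hfin := CalegariDimitrovTang.jumps_finite E
  refine ⟨hfin.toFinset.sup id, fun g hg hne => ?_⟩
  have hmem : ∑ l, (g l : K⟦X⟧) * f l ∈ E := by
    refine Submodule.sum_mem _ fun l _ => ?_
    have hgl : ((g l : K[X]) : K⟦X⟧) =
        ∑ k ∈ Finset.range (d₁ + 1), PowerSeries.C ((g l).coeff k) * (PowerSeries.X : K⟦X⟧) ^ k := by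
      conv_lhs => rw [(g l).as_sum_range_C_mul_X_pow' (Nat.lt_succ_of_le (hg l))]
      rw [show (((∑ k ∈ Finset.range (d₁ + 1), Polynomial.C ((g l).coeff k) * Polynomial.X ^ k : K[X]) :
          K⟦X⟧)) = Polynomial.coeToPowerSeries.ringHom (R := K)
            (∑ k ∈ Finset.range (d₁ + 1), Polynomial.C ((g l).coeff k) * Polynomial.X ^ k) from rfl,
        map_sum]
      refine Finset.sum_congr rfl fun k _ => ?_
      simp [Polynomial.coe_C, Polynomial.coe_X]
    rw [hgl, Finset.sum_mul]
    refine Submodule.sum_mem _ fun k hk => ?_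
    rw [mul_assoc, ← PowerSeries.smul_eq_C_mul]
    refine Submodule.smul_mem _ _ (Submodule.subset_span ⟨(l, ⟨k, Finset.mem_range.mp hk⟩), rfl⟩)
  have hjump : (∑ l, (g l : K⟦X⟧) * f l).order.toNat ∈ CalegariDimitrovTang.jumps E :=
    ⟨_, hmem, hne, rfl⟩
  exact Finset.le_sup (f := id) (hfin.mem_toFinset.mpr hjump)

omit [CharZero K] in
/-- Casting a finite sum of polynomials to power series. [folklore] -/
theorem coe_finset_sum {ι : Type*} (s : Finset ι) (q : ι → K[X]) :
    (((∑ i ∈ s, q i : K[X])) : K⟦X⟧) = ∑ i ∈ s, ((q i : K[X]) : K⟦X⟧) :=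
  map_sum (Polynomial.coeToPowerSeries.ringHom (R := K)) q s

omit [CharZero K] in
/-- Extraction of the rank relation: if `λ_1,…,λ_μ` are independent but `λ_1,…,λ_{μ+1}` are not,
then `d λ_{μ+1} = Σ_{i ≤ μ} a_i λ_i` with `d ≠ 0`. [cite: Mahler1976, Ch. 3 §53 eq. (8)] -/
theorem exists_relation {P : ℕ → Fin m → K[X]} {μ : ℕ}
    (hind : LinearIndependent K[X] (fun i : Fin μ => P i))
    (hdep : ¬ LinearIndependent K[X] (fun i : Fin (μ + 1) => P i)) :
    ∃ d : K[X], d ≠ 0 ∧ ∃ a : Fin μ → K[X], d • P μ = ∑ i, a i • P i := by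
  classical
  obtain ⟨g, hg, i₀, hi₀⟩ := Fintype.not_linearIndependent_iff.mp hdep
  rw [Fin.sum_univ_castSucc] at hg
  simp only [Fin.val_castSucc, Fin.val_last] at hg
  have hlast : g (Fin.last μ) ≠ 0 := by
    intro h0
    rw [h0, zero_smul, add_zero] at hg
    have hzero := Fintype.linearIndependent_iff.mp hind (fun i => g (Fin.castSucc i)) hg
    apply hi₀
    induction i₀ using Fin.lastCases with
    | last => exact h0
    | cast i => exact hzero i
  refine ⟨g (Fin.last μ), hlast, fun i => -g (Fin.castSucc i), ?_⟩
  simp only [neg_smul, Finset.sum_neg_distrib]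
  rw [eq_neg_iff_add_eq_zero, add_comm]
  exact hg

omit [CharZero K] in
/-- Independent rows give a non-zero determinant (domain case). [folklore] -/
theorem det_ne_zero_of_rows_linearIndependent {n : ℕ} (M : Matrix (Fin n) (Fin n) K[X])
    (hM : LinearIndependent K[X] (fun h => M h)) : M.det ≠ 0 := by
  classical
  intro hdet
  obtain ⟨v, hv0, hv⟩ := Matrix.exists_vecMul_eq_zero_iff.mpr hdet
  have : ∑ h, v h • M h = 0 := by
    funext k
    have := congrFun hv k
    simpa [Matrix.vecMul, dotProduct, Finset.sum_apply, Pi.smul_apply, smul_eq_mul, mul_comm] using this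
  obtain ⟨h, hh⟩ := Function.ne_iff.mp hv0
  exact hh (Fintype.linearIndependent_iff.mp hM v this h)

/-- **Shidlovsky's lemma** (Shidlovskii 1959; Mahler, Ch. 3 Theorem 6 with the remark p. 72;
[CalegariDimitrovTang2024, §3.2 Theorem 37]). Let `f_1,…,f_m ∈ K⟦X⟧` (`char K = 0`) be
`K[X]`-linearly independent power series solving a linear differential system
`κ f_h′ = Σ_k B_{hk} f_k` (`κ ∈ K[X] ∖ 0`, `B ∈ M_m(K[X])`; the point `0` may be singular), i.e.
whose `K(X)`-span is `m`-dimensional and closed under `d/dX`. Then there is a constant `C` such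
that for every non-zero vector of polynomials `p_1,…,p_m` of degrees `≤ X`,
`Σ_k p_k f_k ≠ 0` and `ord_0 (Σ_k p_k f_k) ≤ m·X + C`.
[cite: Mahler1976, Ch. 3 Theorem 6 and p. 72; CalegariDimitrovTang2024, §3.2 Theorem 37] -/
theorem shidlovsky {κ : K[X]} (hκ : κ ≠ 0) {B : Matrix (Fin m) (Fin m) K[X]} {f : Fin m → K⟦X⟧}
    (hf : IsSol incl κ B f) (hind : LinearIndependent K[X] f) :
    ∃ C : ℕ, ∀ p : Fin m → K[X], p ≠ 0 → ∀ N : ℕ, (∀ k, (p k).natDegree ≤ N) →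
      evalForm incl p f ≠ 0 ∧ (evalForm incl p f).order.toNat ≤ m * N + C := by
  classical
  -- the auxiliary regular point and the uniformity bound
  obtain ⟨c, hc⟩ := exists_eval_ne_zero hκ
  obtain ⟨d₁, hunif⟩ := uniformity (B := B) hc
  obtain ⟨C₄, hC₄⟩ := exists_order_bound f d₁
  set Cf := Finset.univ.sup (fun k : Fin m => (f k).order.toNat) with hCf
  refine ⟨(m * (m - 1) / 2) * degBound κ B + (m - 1) + C₄ + Cf, fun p hp N hN => ?_⟩
  have hfk : ∀ k, f k ≠ 0 := fun k => hind.ne_zero k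
  have hCf_le : ∀ k, (f k).order.toNat ≤ Cf := fun k =>
    Finset.le_sup (f := fun k : Fin m => (f k).order.toNat) (Finset.mem_univ k)
  obtain ⟨k₀, hk₀⟩ : ∃ k, p k ≠ 0 := by
    by_contra h; push Not at h; exact hp (funext h)
  -- the derived forms and the rank `μ`
  set P : ℕ → Fin m → K[X] := fun h => derivedForm κ B p h with hPdef
  have hP : ∀ h, P (h + 1) = derivOp κ B (P h) := fun h => derivedForm_succ κ B p h
  let Q : ℕ → Prop := fun h => ¬ LinearIndependent K[X] (fun i : Fin h => P i)
  have hQm : Q (m + 1) := by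
    intro hli
    have h := hli.fintype_card_le_finrank
    rw [Module.finrank_fintype_fun_eq_card, Fintype.card_fin, Fintype.card_fin] at h
    omega
  have hQex : ∃ h, Q h := ⟨m + 1, hQm⟩
  set μ' := Nat.find hQex with hμ'
  have hμ'Q : Q μ' := Nat.find_spec hQex
  have hμ'le : μ' ≤ m + 1 := Nat.find_min' hQex hQm
  have hμ'pos : 0 < μ' := by
    rw [Nat.pos_iff_ne_zero]
    intro h0
    rw [h0] at hμ'Q
    exact hμ'Q (linearIndependent_empty_type)
  obtain ⟨μ, hμ⟩ : ∃ μ, μ' = μ + 1 := ⟨μ' - 1, by omega⟩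
  have hdep : ¬ LinearIndependent K[X] (fun i : Fin (μ + 1) => P i) := by rw [← hμ]; exact hμ'Q
  have hindμ : LinearIndependent K[X] (fun i : Fin μ => P i) := by
    have := Nat.find_min hQex (show μ < μ' by omega)
    simpa [Q] using this
  have hμm : μ ≤ m := by omega
  -- `μ ≥ 1` since `p ≠ 0`
  have hμpos : 0 < μ := by
    rw [Nat.pos_iff_ne_zero]
    rintro rfl
    apply hdep
    rw [Fintype.linearIndependent_iff]
    intro g hg i
    rw [Fin.sum_univ_succ, Fin.sum_univ_zero, add_zero] at hg
    have hP0 : P ((0 : Fin (0 + 1)) : ℕ) = p := by simp [hPdef, derivedForm_zero]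
    rw [hP0] at hg
    have hg0 : g 0 = 0 := by
      by_contra hg0
      exact hp ((smul_eq_zero.mp hg).resolve_left hg0)
    have hi : i = 0 := Fin.ext (by have := i.isLt; simp only [Fin.val_zero]; omega)
    rw [hi]
    exact hg0
  obtain ⟨d, hd, a, hrel⟩ := exists_relation hindμ hdep
  -- the two cases
  by_cases hμeq : μ = m
  · -- full rank: Mahler's remark p. 72
    subst hμeq
    have hdet : (derivedMatrix κ B p).det ≠ 0 := by
      refine det_ne_zero_of_rows_linearIndependent _ ?_
      exact hindμ
    obtain ⟨hne, hbound⟩ := order_evalForm_le_of_det_ne_zero κ B hf (hfk k₀) p hN hdet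
    refine ⟨hne, hbound.trans ?_⟩
    have := hCf_le k₀
    omega
  · -- rank-deficient: Shidlovsky's Theorem 6
    have hμlt : μ < m := lt_of_le_of_ne hμm hμeq
    -- a non-singular `μ × μ` minor of the first `μ` derived forms, columns `I`, complement `J`
    obtain ⟨I, hI, hδ⟩ := exists_cols_det_ne_zero (Matrix.of fun (h : Fin μ) (k : Fin m) => P h k) hindμ
    obtain ⟨J, hIJ⟩ := exists_complement I hI
    have hδ' : (Matrix.of fun (h i : Fin μ) => P h (I i)).det ≠ 0 := hδ
    obtain ⟨ε, hε0, hεdeg, η, hηdeg, hεη⟩ := hunif P hP μ hμm d hd a hrel I J hIJ hδ'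
    -- the forms `F_i = ε f_{I i} + Σ_j η_{ij} f_{J j}`
    set e : Fin μ ⊕ Fin (m - μ) ≃ Fin m := Equiv.ofBijective (Sum.elim I J) hIJ with he
    have hsplit : ∀ g : Fin m → K⟦X⟧, ∑ l, g l = ∑ i, g (I i) + ∑ j, g (J j) := by
      intro g
      rw [← Equiv.sum_comp e, Fintype.sum_sum_type]
      rfl
    set Fv : Fin μ → K⟦X⟧ := fun i => (ε : K⟦X⟧) * f (I i) + ∑ j, (η i j : K⟦X⟧) * f (J j) with hFv
    -- coefficient vectors of `F_i`
    have hFne : ∀ i, Fv i ≠ 0 ∧ (Fv i).order.toNat ≤ C₄ := by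
      intro i
      set g : Fin m → K[X] := fun l => Sum.elim (fun i' => if i' = i then ε else 0) (fun j => η i j) (e.symm l)
        with hg
      have hgI : ∀ i', g (I i') = if i' = i then ε else 0 := by
        intro i'
        have : e.symm (I i') = Sum.inl i' := by
          apply e.injective; rw [Equiv.apply_symm_apply]; rfl
        rw [hg]; simp only [this, Sum.elim_inl]
      have hgJ : ∀ j, g (J j) = η i j := by
        intro j
        have : e.symm (J j) = Sum.inr j := by
          apply e.injective; rw [Equiv.apply_symm_apply]; rfl
        rw [hg]; simp only [this, Sum.elim_inr]
      have hgsum : ∑ l, (g l : K⟦X⟧) * f l = Fv i := by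
        rw [hsplit, hFv]
        simp only [hgI, hgJ]
        congr 1
        rw [Finset.sum_eq_single i]
        · simp
        · intro i' _ hi'; rw [if_neg hi', Polynomial.coe_zero, zero_mul]
        · intro h; exact absurd (Finset.mem_univ i) h
      have hgdeg : ∀ l, (g l).natDegree ≤ d₁ := by
        intro l
        obtain ⟨x, rfl⟩ := e.surjective l
        rcases x with i' | j
        · show (g (I i')).natDegree ≤ d₁
          rw [hgI]; split_ifs
          · exact hεdeg
          · simp
        · show (g (J j)).natDegree ≤ d₁
          rw [hgJ]; exact hηdeg i j
      have hne : Fv i ≠ 0 := by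
        rw [← hgsum]
        intro h0
        have hrel0 : ∑ l, g l • f l = 0 := by
          simpa [polynomial_smul_eq_coe_mul] using h0
        have hz := Fintype.linearIndependent_iff.mp hind g hrel0 (I i)
        rw [hgI, if_pos rfl] at hz
        exact hε0 hz
      refine ⟨hne, ?_⟩
      rw [← hgsum] at hne ⊢
      exact hC₄ g hgdeg hne
    -- `ε λ_h(f) = Σ_i P h (I i) F_i` for `h < μ`
    set L : ℕ → K⟦X⟧ := fun h => evalForm incl (P h) f with hL
    have hεL : ∀ h : Fin μ, (ε : K⟦X⟧) * L h = ∑ i, (P h (I i) : K⟦X⟧) * Fv i := by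
      intro h
      have hL' : L h = ∑ i, (P h (I i) : K⟦X⟧) * f (I i) + ∑ j, (P h (J j) : K⟦X⟧) * f (J j) := by
        rw [hL]; simp only [evalForm, incl_apply]; rw [hsplit]
      have hJterm : ∀ j, (ε : K⟦X⟧) * ((P h (J j) : K⟦X⟧) * f (J j)) =
          ∑ i, (P h (I i) : K⟦X⟧) * ((η i j : K⟦X⟧) * f (J j)) := by
        intro j
        rw [← mul_assoc, ← Polynomial.coe_mul, hεη h j, coe_finset_sum, Finset.sum_mul]
        exact Finset.sum_congr rfl fun i _ => by rw [Polynomial.coe_mul]; ring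
      rw [hL', mul_add, Finset.mul_sum, Finset.mul_sum]
      simp_rw [hJterm]
      rw [Finset.sum_comm, ← Finset.sum_add_distrib]
      refine Finset.sum_congr rfl fun i _ => ?_
      rw [hFv]; simp only; rw [mul_add, Finset.mul_sum]
      congr 1
      · ring
    -- Cramer with the minor on the columns `I`
    set RI : Matrix (Fin μ) (Fin μ) K[X] := Matrix.of fun h i => P h (I i) with hRI
    set Rm : Matrix (Fin μ) (Fin μ) K⟦X⟧ := RI.map incl with hRm
    have hdetm : Rm.det = incl RI.det := by rw [hRm, RingHom.map_det, RingHom.mapMatrix_apply]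
    have hRmF : ∀ h, Rm.mulVec Fv h = (ε : K⟦X⟧) * L h := by
      intro h
      rw [Matrix.mulVec, dotProduct, hεL h]
      rfl
    have hcramer : ∀ i, (incl RI.det) * Fv i = ∑ h, Rm.adjugate i h * ((ε : K⟦X⟧) * L h) := by
      intro i
      have h1 : Rm.adjugate.mulVec (Rm.mulVec Fv) = Rm.det • Fv := by
        rw [Matrix.mulVec_mulVec, Matrix.adjugate_mul, Matrix.smul_mulVec, Matrix.one_mulVec]
      have h2 := congrFun h1 i
      rw [Pi.smul_apply, smul_eq_mul, hdetm] at h2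
      rw [← h2, Matrix.mulVec, dotProduct]
      exact Finset.sum_congr rfl fun h _ => by rw [hRmF h]
    have hδ0 : (incl RI.det : K⟦X⟧) ≠ 0 := by
      rw [incl_apply, Ne, Polynomial.coe_eq_zero_iff]; exact hδ'
    -- `λ(f) ≠ 0`
    set i₀ : Fin μ := ⟨0, hμpos⟩ with hi₀
    have hsucc : ∀ h : ℕ, L (h + 1) = incl κ * PowerSeries.derivative K (L h) := fun h =>
      evalForm_derivedForm_succ incl derivative_incl p hf h
    have hL0 : L 0 = evalForm incl p f := by rw [hL]; simp only [hPdef, derivedForm_zero]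
    have hne : evalForm incl p f ≠ 0 := by
      intro h0
      have hall : ∀ h : ℕ, L h = 0 := by
        intro h
        induction h with
        | zero => rw [hL0, h0]
        | succ h ih => rw [hsucc, ih, map_zero, mul_zero]
      have : (incl RI.det) * Fv i₀ = 0 := by
        rw [hcramer]; exact Finset.sum_eq_zero fun h _ => by rw [hall h, mul_zero, mul_zero]
      rcases mul_eq_zero.mp this with h | h
      · exact hδ0 h
      · exact (hFne i₀).1 h
    refine ⟨hne, ?_⟩
    -- orders
    set y := (evalForm incl p f).order.toNat with hy
    have hyeq : (evalForm incl p f).order = y := (PowerSeries.coe_toNat_order hne).symm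
    have hLh : ∀ h : Fin μ, ((y - (m - 1) : ℕ) : ℕ∞) ≤ (L h).order := by
      intro h
      have h1 := order_evalForm_le κ B p hf h
      rw [hyeq] at h1
      change (y : ℕ∞) ≤ (L h).order + (h : ℕ) at h1
      by_cases htop : (L h).order = ⊤
      · rw [htop]; exact le_top
      · have h2 : (L h).order = (L h).order.toNat := (ENat.coe_toNat htop).symm
        rw [h2] at h1 ⊢
        have h3 : y ≤ (L h).order.toNat + h := by exact_mod_cast h1
        have h4 : (h : ℕ) ≤ m - 1 := by have := h.isLt; omega
        exact_mod_cast (show y - (m - 1) ≤ (L h).order.toNat by omega)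
    have hsum : ((y - (m - 1) : ℕ) : ℕ∞) ≤ (∑ h : Fin μ, Rm.adjugate i₀ h * ((ε : K⟦X⟧) * L h)).order :=
      le_order_sum _ _ fun h _ => (hLh h).trans (by
        rw [PowerSeries.order_mul, PowerSeries.order_mul]
        exact le_trans le_add_self le_add_self)
    rw [← hcramer i₀, PowerSeries.order_mul] at hsum
    -- degree of the minor
    have hdegδ : RI.det.natDegree ≤ m * N + (m * (m - 1) / 2) * degBound κ B := by
      have h1 : RI.det.natDegree ≤ ∑ h : Fin μ, (N + h * degBound κ B) :=
        natDegree_det_le_sum RI (fun h => N + h * degBound κ B) fun h i => natDegree_derivedForm_le κ B hN h (I i)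
      refine h1.trans ?_
      rw [Finset.sum_add_distrib, Finset.sum_const, Finset.card_univ, Fintype.card_fin, smul_eq_mul,
        ← Finset.sum_mul, Fin.sum_univ_eq_sum_range (fun i => i) μ, Finset.sum_range_id]
      have h2 : μ * (μ - 1) / 2 ≤ m * (m - 1) / 2 :=
        Nat.div_le_div_right (Nat.mul_le_mul hμm (by omega))
      have h3 : μ * N ≤ m * N := Nat.mul_le_mul_right N hμm
      have h4 : μ * (μ - 1) / 2 * degBound κ B ≤ m * (m - 1) / 2 * degBound κ B := Nat.mul_le_mul_right _ h2
      omega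
    have hordδ : (incl RI.det : K⟦X⟧).order ≤ (m * N + (m * (m - 1) / 2) * degBound κ B : ℕ) :=
      (order_coe_le_natDegree hδ').trans (by exact_mod_cast hdegδ)
    have hΔnat : (incl RI.det : K⟦X⟧).order = (incl RI.det : K⟦X⟧).order.toNat :=
      (PowerSeries.coe_toNat_order hδ0).symm
    have hFnat : (Fv i₀).order = (Fv i₀).order.toNat := (PowerSeries.coe_toNat_order (hFne i₀).1).symm
    rw [hΔnat, hFnat] at hsum
    rw [hΔnat] at hordδ
    have h5 : y - (m - 1) ≤ (incl RI.det : K⟦X⟧).order.toNat + (Fv i₀).order.toNat := by exact_mod_cast hsum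
    have h6 : (incl RI.det : K⟦X⟧).order.toNat ≤ m * N + (m * (m - 1) / 2) * degBound κ B := by exact_mod_cast hordδ
    have h7 := (hFne i₀).2
    omega

/-- **[CalegariDimitrovTang2024, Theorem 37] form of Shidlovsky's lemma**: with the degrees
bounded strictly by `D`, `ord_{x=0}(Q_1 f_1 + … + Q_m f_m) ≤ m D + C` for all `D` and all
`(Q_1,…,Q_m) ≠ 0` with `deg Q_i < D`. (Hypotheses as in `shidlovsky`: the `f_i` are
`K[X]`-linearly independent — equivalently `K(X)`-linearly independent — power series solutions
of a linear differential system `κ f′ = B f` over `K(X)`, i.e. they span an `m`-dimensional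
`K(X)`-space closed under `d/dX`.)
[cite: CalegariDimitrovTang2024, §3.2 Theorem 37; Mahler1976, Ch. 3 Theorem 6, p. 72] -/
theorem shidlovsky_cdt {κ : K[X]} (hκ : κ ≠ 0) {B : Matrix (Fin m) (Fin m) K[X]} {f : Fin m → K⟦X⟧}
    (hf : IsSol incl κ B f) (hind : LinearIndependent K[X] f) :
    ∃ C : ℕ, ∀ D : ℕ, ∀ Q : Fin m → K[X], Q ≠ 0 → (∀ k, (Q k).natDegree < D) →
      ∑ k, (Q k : K⟦X⟧) * f k ≠ 0 ∧ (∑ k, (Q k : K⟦X⟧) * f k).order.toNat ≤ m * D + C := by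
  obtain ⟨C, hC⟩ := shidlovsky hκ hf hind
  refine ⟨C, fun D Q hQ hdeg => ?_⟩
  have hD : 0 < D := by
    obtain ⟨k, -⟩ : ∃ k : Fin m, Q k ≠ 0 := by
      by_contra h
      push Not at h
      exact hQ (funext h)
    exact lt_of_le_of_lt (Nat.zero_le _) (hdeg k)
  obtain ⟨hne, hle⟩ := hC Q hQ (D - 1) fun k => Nat.le_sub_one_of_lt (hdeg k)
  refine ⟨hne, hle.trans ?_⟩
  have : m * (D - 1) ≤ m * D := Nat.mul_le_mul_left m (Nat.sub_le D 1)
  omega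

/-- **[CalegariDimitrovTang2024, Theorem 37 (Shidlovsky)] as printed, in the language of vanishing
filtration jumps**: for a system `f_1,…,f_m` whose `K(x)`-span is `m`-dimensional and closed under
`d/dx` (here: `K[X]`-independent solutions of `κ f′ = B f`, `κ ≠ 0`), there is `C = C(f)` with
`𝒱(E_D) ⊆ {0, 1, …, mD + C}` and `#𝒱(E_D) = mD` for every `D`, where `E_D` is the evaluation
module `Σ_{i, k<D} K·x^k f_i`. [cite: CalegariDimitrovTang2024, §3.2 Theorem 37 (eq. (3.4))] -/
theorem shidlovsky_jumps {κ : K[X]} (hκ : κ ≠ 0) {B : Matrix (Fin m) (Fin m) K[X]} {f : Fin m → K⟦X⟧}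
    (hf : IsSol incl κ B f) (hind : LinearIndependent K[X] f) :
    ∃ C : ℕ, ∀ D : ℕ,
      CalegariDimitrovTang.jumps (CalegariDimitrovTang.evalModule f D) ⊆ Set.Iic (m * D + C) ∧
      (CalegariDimitrovTang.jumps (CalegariDimitrovTang.evalModule f D)).ncard = m * D := by
  classical
  obtain ⟨C, hC⟩ := shidlovsky_cdt hκ hf hind
  refine ⟨C, fun D => ⟨?_, ?_⟩⟩
  · rintro n ⟨g, hg, hgne, rfl⟩
    -- write `g = Σ_i Q_i f_i` with `deg Q_i < D`
    obtain ⟨c, hc⟩ := (Submodule.mem_span_range_iff_exists_fun K).mp hg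
    set Q : Fin m → K[X] := fun i => ∑ k : Fin D, Polynomial.C (c (i, k)) * Polynomial.X ^ (k : ℕ)
      with hQ
    have hgQ : g = ∑ i, (Q i : K⟦X⟧) * f i := by
      rw [← hc, Fintype.sum_prod_type]
      refine Finset.sum_congr rfl fun i _ => ?_
      rw [hQ, coe_finset_sum, Finset.sum_mul]
      refine Finset.sum_congr rfl fun k _ => ?_
      rw [Polynomial.coe_mul, Polynomial.coe_pow, Polynomial.coe_C, Polynomial.coe_X,
        PowerSeries.smul_eq_C_mul, mul_assoc]
    have hD : 0 < D := by
      rw [Nat.pos_iff_ne_zero]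
      rintro rfl
      apply hgne
      rw [hgQ]
      exact Finset.sum_eq_zero fun i _ => by simp [hQ]
    have hQne : Q ≠ 0 := by
      intro h0
      apply hgne
      rw [hgQ, h0]
      simp
    have hdeg : ∀ i, (Q i).natDegree < D := by
      intro i
      have h1 : (Q i).natDegree ≤ D - 1 :=
        natDegree_sum_le_of_forall_le _ _ fun k _ =>
          (natDegree_C_mul_X_pow_le (c (i, k)) (k : ℕ)).trans (Nat.le_sub_one_of_lt k.isLt)
      omega
    rw [Set.mem_Iic, hgQ]
    exact (hC D Q hQne hdeg).2
  · rw [CalegariDimitrovTang.ncard_jumps, CalegariDimitrovTang.finrank_evalModule f hind]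

/-- **[CalegariDimitrovTang2024, Lemma 41], the case `ε = 0`** (the `K(x)`-span of `f_1,…,f_m`
closed under `d/dx`, via Theorem 37 and Corollary 34): there is `C = C(f)` such that for all
`d, D` and every non-zero `F(𝐱) = Σ_𝐢 Q_𝐢(𝐱) f_{i_1}(x_1)⋯f_{i_d}(x_d)` with `deg_{x_j} Q_𝐢 < D`
(any non-zero element of the `d`-th Cartesian power of the evaluation module `E_D`, cf.
`CalegariDimitrovTang.tprod_mem_prodModule_evalModule`), every lowest-order non-zero monomial
`β 𝐱^𝐧` of `F` has all `n_j ≤ m D + C`.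
[cite: CalegariDimitrovTang2024, §3.2 Lemma 41 (last sentence, ε = 0)] -/
theorem shidlovsky_lowestOrder {κ : K[X]} (hκ : κ ≠ 0) {B : Matrix (Fin m) (Fin m) K[X]}
    {f : Fin m → K⟦X⟧} (hf : IsSol incl κ B f) (hind : LinearIndependent K[X] f) :
    ∃ C : ℕ, ∀ (d D : ℕ) (F : MvPowerSeries (Fin d) K),
      F ∈ CalegariDimitrovTang.prodModule (CalegariDimitrovTang.evalModule f D) d →
      ∀ n : Fin d →₀ ℕ, MvPowerSeries.coeff n F ≠ 0 →
        (∀ n' : Fin d →₀ ℕ, MvPowerSeries.coeff n' F ≠ 0 → n.degree ≤ n'.degree) →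
        ∀ s, n s ≤ m * D + C := by
  obtain ⟨C, hC⟩ := shidlovsky_jumps hκ hf hind
  refine ⟨C, fun d D F hF n hn hmin s => ?_⟩
  have := (hC D).1 (CalegariDimitrovTang.jumps_cartesian _ hF hn hmin s)
  exact Set.mem_Iic.mp this

end Main

end

end Shidlovsky

end Literature.NumberTheory.Transcendental
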